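import Summits.CriticalPhenomena.PercolationContinuityZ3.Theorems.PercNearOneGluingNoHeavyLowerTailSunflowerLeafLeafFreeCap
import HarnessLib

/-!
# `NoHeavyLowerTail` (crux stmt-CriticalPhenomena-4575), abstract sunflower cubic: `FreeFour` — the EXACT residual after the exchange,
# capped and diagonal reductions: families with exactly one column resource off its link (`FreeFourOneX`)

Support file (seat `prim-ineq-prove-1` gen 67; `--supports stmt-CriticalPhenomena-4575`).  No `sorry`, no named facts; one definition
(`FreeFourOneX`, conjecture-shaped) used only as a hypothesis.  Memo: run/shared/lean/prim/prim-ineq-prove-1/FINDING-FREEFOUR-prove1-g67.md §4.4.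

`FreeFourOneX σ s τ t α` is `FreeFour` (`…SunflowerLeafLeafFree`) restricted to families with a distinguished petal `k` such that every
OTHER column resource sits at its link (`x_j = (1−σ)e_j + σf_j`, `j ≠ k`) while `x_k` is strictly between its link and `1`; no condition
on the row resources.  **`freeFour_of_oneX : FreeFourOneX ⇒ FreeFour`** (exchange `freeFour_of_freeFourCore`, cap `freeFour_of_xCap`,
diagonal class `freeFour_of_xLink`).  This is the loss-free form of the residual; `CrossIneq` (`…SunflowerLeafLeafFreeCross`) is a
sufficient `t`-free condition for it.
-/

noncomputable section

namespace Summit.CriticalPhenomena.PercolationContinuityZ3.Theorems.SunflowerPartition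

namespace SafeCalc

namespace LeafLeafZ

open Finset LinkedCurrency

/-- **`FreeFourOneX` (statement)**: `FreeFour` for families with exactly one column resource strictly between its link and `1`, all other
column resources at their links. [conjecture-shaped hypothesis, this work] -/
def FreeFourOneX (σ s τ t α00 α01 α10 α11 : ℝ) : Prop :=
  ∀ (n : ℕ) (e g f h y x : Fin n → ℝ) (k : Fin n),
    (∀ j, α00 ≤ e j) → (∀ j, α01 ≤ g j) → (∀ j, α10 ≤ f j) → (∀ j, α11 ≤ h j) → (∀ j, h j ≤ 1) →
    (∀ j, e j ≤ g j) → (∀ j, e j ≤ f j) → (∀ j, g j ≤ h j) → (∀ j, f j ≤ h j) →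
    (∀ j, (1 - s) * e j + s * g j ≤ y j) → (∀ j, y j ≤ 1) → (∀ j, (1 - σ) * e j + σ * f j ≤ x j) → (∀ j, x j ≤ 1) →
    ∏ j, e j ≤ α00 ^ (n - 1) → ∏ j, g j ≤ α01 ^ (n - 1) → ∏ j, f j ≤ α10 ^ (n - 1) → ∏ j, h j ≤ α11 ^ (n - 1) →
    ∏ j, ((1 - s) * e j + s * g j) ≤ ((1 - s) * α00 + s * α01) ^ (n - 1) →
    ∏ j, ((1 - s) * f j + s * h j) ≤ ((1 - s) * α10 + s * α11) ^ (n - 1) →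
    ∏ j, ((1 - σ) * e j + σ * f j) ≤ ((1 - σ) * α00 + σ * α10) ^ (n - 1) →
    ∏ j, ((1 - σ) * g j + σ * h j) ≤ ((1 - σ) * α01 + σ * α11) ^ (n - 1) →
    ∏ j, ((1 - σ) * ((1 - s) * e j + s * g j) + σ * ((1 - s) * f j + s * h j)) ≤
      ((1 - σ) * ((1 - s) * α00 + s * α01) + σ * ((1 - s) * α10 + s * α11)) ^ (n - 1) →
    ∏ j, y j ≤ ((1 - s) * α00 + s * α01) ^ (n - 1) →
    ∏ j, x j ≤ ((1 - σ) * α00 + σ * α10) ^ (n - 1) →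
    (1 - σ) * e k + σ * f k < x k → x k < 1 → (∀ j, j ≠ k → x j = (1 - σ) * e j + σ * f j) →
    ∏ j, (τ * t + τ * (1 - t) * σ + (1 - τ) * t * s + τ * (1 - t) * (1 - σ) * y j + (1 - τ) * t * (1 - s) * x j +
        (1 - τ) * (1 - t) * ((1 - σ) * ((1 - s) * e j + s * g j) + σ * ((1 - s) * f j + s * h j))) ≤
      (τ * t + τ * (1 - t) * σ + (1 - τ) * t * s + τ * (1 - t) * (1 - σ) * ((1 - s) * α00 + s * α01) +
        (1 - τ) * t * (1 - s) * ((1 - σ) * α00 + σ * α10) +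
        (1 - τ) * (1 - t) * ((1 - σ) * ((1 - s) * α00 + s * α01) + σ * ((1 - s) * α10 + s * α11))) ^ (n - 1)

/-- **`FreeFourOneX ⇒ FreeFour`** (coins in `[0,1]`, floors `0 < α₀₀ ≤ α₀₁, α₁₀ ≤ α₁₁ ≤ 1`). [this work] -/
theorem freeFour_of_oneX {σ s τ t α00 α01 α10 α11 : ℝ} (hσ0 : 0 ≤ σ) (hσ1 : σ ≤ 1) (hs0 : 0 ≤ s) (hs1 : s ≤ 1)
    (hτ0 : 0 ≤ τ) (hτ1 : τ ≤ 1) (ht0 : 0 ≤ t) (ht1 : t ≤ 1) (hα : 0 < α00) (h01 : α00 ≤ α01) (h10 : α00 ≤ α10)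
    (h0111 : α01 ≤ α11) (h1011 : α10 ≤ α11) (h11 : α11 ≤ 1) (hX : FreeFourOneX σ s τ t α00 α01 α10 α11) :
    FreeFour σ s τ t α00 α01 α10 α11 := by
  classical
  refine freeFour_of_freeFourCore hσ0 hσ1 hs0 hs1 hτ0 hτ1 ht0 ht1 hα ?_
  intro n e g f h y x he hg hf hh hh1 leg lef lgh lfh ly hy1 lx hx1 Be Bg Bf Bh Br0 Br1 Bc0 Bc1 BA By Bx _hcy hcx
  by_cases hxcap : ∃ k, x k = 1
  · obtain ⟨k, hk⟩ := hxcap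
    exact freeFour_of_xCap hσ0 hσ1 hs0 hs1 hτ0 hτ1 ht0 ht1 hα h01 h10 h0111 h1011 h11 e g f h y x he hg hf hh hh1 lef lgh lfh ly hy1
      lx Bh Br1 Bc1 BA By Bx k hk
  have hxlt1 : ∀ j, x j < 1 := fun j => lt_of_le_of_ne (hx1 j) fun h1 => hxcap ⟨j, h1⟩
  by_cases hxint : ∃ k, (1 - σ) * e k + σ * f k < x k
  swap
  · have hxl : ∀ j, x j = (1 - σ) * e j + σ * f j := fun j => le_antisymm (not_lt.1 fun h1 => hxint ⟨j, h1⟩) (lx j)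
    have e1 : ∀ j, τ * t + τ * (1 - t) * σ + (1 - τ) * t * s + τ * (1 - t) * (1 - σ) * y j + (1 - τ) * t * (1 - s) * x j +
        (1 - τ) * (1 - t) * ((1 - σ) * ((1 - s) * e j + s * g j) + σ * ((1 - s) * f j + s * h j)) =
        τ * t + τ * (1 - t) * σ + (1 - τ) * t * s + τ * (1 - t) * (1 - σ) * y j + (1 - τ) * t * (1 - s) * ((1 - σ) * e j + σ * f j) +
        (1 - τ) * (1 - t) * ((1 - σ) * ((1 - s) * e j + s * g j) + σ * ((1 - s) * f j + s * h j)) := fun j => by rw [hxl j]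
    rw [prod_congr rfl fun j _ => e1 j]
    exact freeFour_of_xLink hσ0 hσ1 hs0 hs1 hτ0 hτ1 ht0 ht1 hα h01 h10 h0111 h1011 h11 e g f h y he hg hf hh hh1 leg lef lgh lfh ly hy1
      By Br1 BA Bc0
  obtain ⟨k, hk⟩ := hxint
  have hxl : ∀ j, j ≠ k → x j = (1 - σ) * e j + σ * f j := by
    intro j hj
    by_contra hne
    have hlt : (1 - σ) * e j + σ * f j < x j := lt_of_le_of_ne (lx j) (Ne.symm hne)
    exact hj (hcx k j hk (hxlt1 k) hlt (hxlt1 j)).symm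
  exact hX n e g f h y x k he hg hf hh hh1 leg lef lgh lfh ly hy1 lx hx1 Be Bg Bf Bh Br0 Br1 Bc0 Bc1 BA By Bx hk (hxlt1 k) hxl

end LeafLeafZ

end SafeCalc

end Summit.CriticalPhenomena.PercolationContinuityZ3.Theorems.SunflowerPartition
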